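import Literature.MathematicalPhysics.QuantumLattice.TIGroundEnergyDensityConservedDensities
import Literature.MathematicalPhysics.QuantumLattice.HubbardTTPrimePhaseCoexistenceExclusion
import HarnessLib

/-!
# Phase coexistence forces an affine piece of the constrained energy — MODEL-FREE, for ANY family of
# conserved charges: one certified strict-convexity defect of `c ↦ e_c(Ψ)` along a segment in CHARGE
# SPACE excludes macroscopic coexistence of the endpoint phases (filling; filling × magnetization; …)

Topic `Literature/MathematicalPhysics/QuantumLattice` (general `d`, any finite-range interaction `Ψ` on
`ℤ^d`, any charge family `C : κ → FermionInteraction d`). The companion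
`TIGroundEnergyDensityConservedDensities` defines the constraint classes
`tiClassWith C R c = {ω TI : e_{C_k}(ω) = c_k ∀ k}` and proves that the constrained variational density
`e_c(Ψ) := infMeanEnergyOn (tiClassWith C R c) Ψ R` is JOINTLY CONVEX in the charge vector `c`
(`infMeanEnergyOn_tiClassWith_convex_comb_le`, Ruelle 1969 §3.4). The file
`HubbardTTPrimePhaseCoexistenceExclusion` draws the «competing order» consequence for the ONE-BAND `t–t'`
Hubbard model and the filling only. Here the same is PROVED once for every model and every charge family:

* §1 `infMeanEnergyOn_tiClassWith_eq_convexComb_of_mix_le` — if a mixture `λω₁ + (1−λ)ω₂` of states of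
  charges `c₁, c₂` is a CONSTRAINED MINIMISER at its own charges `λc₁ + (1−λ)c₂` (macroscopic COEXISTENCE
  of the two phases), then the CHORD IDENTITY `e_{λc₁+(1−λ)c₂} = λ e_{c₁} + (1−λ) e_{c₂}` holds and both
  components are constrained minimisers (`meanEnergy_eq_infMeanEnergyOn_tiClassWith_of_mix_le_left/right`);
* §2 `infMeanEnergyOn_tiClassWith_eq_chord_on_segment_of_mix_le` — hence `e` is AFFINE on the whole
  segment `[c₁, c₂]` of charge space (real analysis `convexOn_affine_of_eq_convexComb` on the restriction
  `s ↦ e_{(1−s)c₁ + s c₂}`, which is convex on `[0, 1]`, `convexOn_infMeanEnergyOn_tiClassWith_segment`);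
* §3 EXCLUSION READINGS: one strict-convexity defect at an interior point of the segment
  (`…_lt_meanEnergy_mix_of_strict_at`), its certified CAP/FLOORS form (`…_of_cap_lt_floors`), the
  SUPER-SEGMENT form (`…_of_strict_at_of_mem_segment`: the same defect excludes coexistence of every pair
  of phases whose charges lie on the segment OUTSIDE the defect's sub-segment — `affine_subchord_of_eq_chord`),
  and the ENERGY GAP of the phase-separated state (`convexComb_floors_le_meanEnergy_mix_tiClassWith`,
  `infMeanEnergyOn_tiClassWith_add_margin_le_meanEnergy_mix`).

READINGS (D-0096 (ii)/(iii), D-0098: phase maps over `T × P × H`): with `C = (n)` this is phase separation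
in the filling for ANY lattice fermion model (`t–t'–t''`, bilayers, attractive `U`, extended Hubbard, …);
with `C = (n, n↑ − n↓)` (`hubbardCharges`) a certified defect along a segment of the `(ρ, m)` plane
excludes coexistence of, e.g., an unpolarised phase at `(ρ₁, 0)` and a polarised phase at `(ρ₂, m₂)` —
the field axis `H` of the phase map at `T = 0`. HONEST SCOPE: statements about translation-invariant states
and two-component convex decompositions; periodic / finite-period states carry ONE charge vector and are
not excluded; nothing here identifies `e_c` with torus sector energies (the tree has that for the filling
of the `t–t'` model only). Everything is PROVED; no definition, no named fact.

## Mathlib / tree search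
REUSED: `InfVolFermionState.tiClassWith`, `mix_mem_tiClassWith`, `FermionInteraction.infMeanEnergyOn`,
`infMeanEnergyOn_le_meanEnergy`, `infMeanEnergyOn_tiClassWith_convex_comb_le`
(`TIGroundEnergyDensityConservedDensities` / `…CouplingFamilies`); `InfVolFermionState.meanEnergy_mix`;
`convexOn_affine_of_eq_convexComb`, `affine_subchord_of_eq_chord` (`HubbardTTPrimePhaseCoexistenceExclusion`).
`lean search 'tiClassWith.*mix|coexist'`: only the two files above (2026-08-28).

## References
* D. Ruelle, *Statistical Mechanics: Rigorous Results* (1969), §3.4. [cite: Ruelle1969, §3.4]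
* R. B. Israel, *Convexity in the Theory of Lattice Gases* (1979), Thm. I.2.4. [cite: Israel1979, Thm. I.2.4]
* V. J. Emery, S. A. Kivelson, H. Q. Lin, Phys. Rev. Lett. 64 (1990) 475. [cite: EmeryKivelsonLin1990, pp. 475–476]
-/

noncomputable section

open scoped ComplexOrder BigOperators

namespace Literature.MathematicalPhysics.QuantumLattice

open InfVolFermionState FermionInteraction Set

variable {d : ℕ} {κ : Type*} (C : κ → FermionInteraction d) (Ψ : FermionInteraction d) (R : ℝ)

/-! ### §0 The segment restriction `s ↦ e_{(1−s)c₁ + s c₂}` is convex on `[0, 1]` -/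

/-- Points of the charge segment are realised by mixtures: `(1−s)c₁ + s c₂` is the charge vector of
`(1−s)·ω₁ + s·ω₂`. [cite: Ruelle1969, §3.4] -/
theorem tiClassWith_segment_nonempty {c₁ c₂ : κ → ℝ} {ω₁ ω₂ : InfVolFermionState d}
    (h₁ : ω₁ ∈ tiClassWith C R c₁) (h₂ : ω₂ ∈ tiClassWith C R c₂) {s : ℝ} (hs0 : 0 ≤ s) (hs1 : s ≤ 1) :
    (tiClassWith C R (fun k => (1 - s) * c₁ k + s * c₂ k)).Nonempty := by
  have hmix := mix_mem_tiClassWith C R h₁ h₂ (1 - s) (by linarith) (by linarith)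
  have hfun : (fun k => (1 - s) * c₁ k + (1 - (1 - s)) * c₂ k) = (fun k => (1 - s) * c₁ k + s * c₂ k) := by
    funext k; ring
  rw [hfun] at hmix
  exact ⟨_, hmix⟩

/-- **The segment restriction is convex on `[0,1]`**: `s ↦ e_{(1−s)c₁ + s c₂}(Ψ)` is convex on `Icc 0 1`
whenever the endpoints are realised. [cite: Ruelle1969, §3.4] -/
theorem convexOn_infMeanEnergyOn_tiClassWith_segment {c₁ c₂ : κ → ℝ} {ω₁ ω₂ : InfVolFermionState d}
    (h₁ : ω₁ ∈ tiClassWith C R c₁) (h₂ : ω₂ ∈ tiClassWith C R c₂) :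
    ConvexOn ℝ (Icc (0 : ℝ) 1)
      (fun s => infMeanEnergyOn (tiClassWith C R (fun k => (1 - s) * c₁ k + s * c₂ k)) Ψ R) := by
  refine ⟨convex_Icc 0 1, fun x hx y hy a b ha hb hab => ?_⟩
  have hxne := tiClassWith_segment_nonempty C R h₁ h₂ hx.1 hx.2
  have hyne := tiClassWith_segment_nonempty C R h₁ h₂ hy.1 hy.2
  have hconv := infMeanEnergyOn_tiClassWith_convex_comb_le C Ψ R hxne hyne ha hb hab
  have hfun : (fun k => a * ((1 - x) * c₁ k + x * c₂ k) + b * ((1 - y) * c₁ k + y * c₂ k)) =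
      (fun k => (1 - (a * x + b * y)) * c₁ k + (a * x + b * y) * c₂ k) := by
    funext k
    have hb' : b = 1 - a := by linarith
    rw [hb']; ring
  rw [hfun] at hconv
  simpa only [smul_eq_mul] using hconv

namespace InfVolFermionState

/-! ### §1 Coexistence forces the chord identity in charge space -/

/-- **Phase coexistence forces the chord identity (any model, any charges).** Let `ω₁ ∈ tiClassWith C R c₁`,
`ω₂ ∈ tiClassWith C R c₂`, `0 ≤ λ ≤ 1`, and suppose the mixture `λω₁ + (1−λ)ω₂` is a CONSTRAINED MINIMISER at
its own charges: `e_Ψ(mixture) ≤ e_{λc₁+(1−λ)c₂}(Ψ)` (hence `=`). Then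
`e_{λc₁+(1−λ)c₂} = λ e_{c₁} + (1−λ) e_{c₂}`. [cite: Israel1979, Thm. I.2.4] [cite: Ruelle1969, §3.4] -/
theorem infMeanEnergyOn_tiClassWith_eq_convexComb_of_mix_le {c₁ c₂ : κ → ℝ} {ω₁ ω₂ : InfVolFermionState d}
    (h₁ : ω₁ ∈ tiClassWith C R c₁) (h₂ : ω₂ ∈ tiClassWith C R c₂) {lam : ℝ} (hl0 : 0 ≤ lam) (hl1 : lam ≤ 1)
    (hGS : (mix lam hl0 hl1 ω₁ ω₂).meanEnergy Ψ R ≤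
      infMeanEnergyOn (tiClassWith C R (fun k => lam * c₁ k + (1 - lam) * c₂ k)) Ψ R) :
    infMeanEnergyOn (tiClassWith C R (fun k => lam * c₁ k + (1 - lam) * c₂ k)) Ψ R =
      lam * infMeanEnergyOn (tiClassWith C R c₁) Ψ R + (1 - lam) * infMeanEnergyOn (tiClassWith C R c₂) Ψ R := by
  have hv₁ := infMeanEnergyOn_le_meanEnergy Ψ R h₁
  have hv₂ := infMeanEnergyOn_le_meanEnergy Ψ R h₂
  have hconv := infMeanEnergyOn_tiClassWith_convex_comb_le C Ψ R ⟨ω₁, h₁⟩ ⟨ω₂, h₂⟩ hl0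
    (by linarith : 0 ≤ 1 - lam) (by ring)
  rw [meanEnergy_mix] at hGS
  refine le_antisymm hconv ?_
  have k1 := mul_le_mul_of_nonneg_left hv₁ hl0
  have k2 := mul_le_mul_of_nonneg_left hv₂ (by linarith : 0 ≤ 1 - lam)
  linarith

/-- **… and the first component is a constrained minimiser** (`0 < λ`): `e_Ψ(ω₁) = e_{c₁}(Ψ)`.
[cite: Israel1979, Thm. I.2.4] -/
theorem meanEnergy_eq_infMeanEnergyOn_tiClassWith_of_mix_le_left {c₁ c₂ : κ → ℝ}
    {ω₁ ω₂ : InfVolFermionState d} (h₁ : ω₁ ∈ tiClassWith C R c₁) (h₂ : ω₂ ∈ tiClassWith C R c₂)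
    {lam : ℝ} (hl0 : 0 < lam) (hl1 : lam ≤ 1)
    (hGS : (mix lam hl0.le hl1 ω₁ ω₂).meanEnergy Ψ R ≤
      infMeanEnergyOn (tiClassWith C R (fun k => lam * c₁ k + (1 - lam) * c₂ k)) Ψ R) :
    ω₁.meanEnergy Ψ R = infMeanEnergyOn (tiClassWith C R c₁) Ψ R := by
  have hv₁ := infMeanEnergyOn_le_meanEnergy Ψ R h₁
  have hv₂ := infMeanEnergyOn_le_meanEnergy Ψ R h₂
  have hconv := infMeanEnergyOn_tiClassWith_convex_comb_le C Ψ R ⟨ω₁, h₁⟩ ⟨ω₂, h₂⟩ hl0.le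
    (by linarith : 0 ≤ 1 - lam) (by ring)
  rw [meanEnergy_mix] at hGS
  refine le_antisymm ?_ hv₁
  have k2 := mul_le_mul_of_nonneg_left hv₂ (by linarith : 0 ≤ 1 - lam)
  by_contra hlt
  have hlt' := lt_of_not_ge hlt
  have k1 : lam * infMeanEnergyOn (tiClassWith C R c₁) Ψ R < lam * ω₁.meanEnergy Ψ R :=
    mul_lt_mul_of_pos_left hlt' hl0
  linarith

/-- **… and the second component is a constrained minimiser** (`λ < 1`): `e_Ψ(ω₂) = e_{c₂}(Ψ)`.
[cite: Israel1979, Thm. I.2.4] -/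
theorem meanEnergy_eq_infMeanEnergyOn_tiClassWith_of_mix_le_right {c₁ c₂ : κ → ℝ}
    {ω₁ ω₂ : InfVolFermionState d} (h₁ : ω₁ ∈ tiClassWith C R c₁) (h₂ : ω₂ ∈ tiClassWith C R c₂)
    {lam : ℝ} (hl0 : 0 ≤ lam) (hl1 : lam < 1)
    (hGS : (mix lam hl0 hl1.le ω₁ ω₂).meanEnergy Ψ R ≤
      infMeanEnergyOn (tiClassWith C R (fun k => lam * c₁ k + (1 - lam) * c₂ k)) Ψ R) :
    ω₂.meanEnergy Ψ R = infMeanEnergyOn (tiClassWith C R c₂) Ψ R := by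
  have hv₁ := infMeanEnergyOn_le_meanEnergy Ψ R h₁
  have hv₂ := infMeanEnergyOn_le_meanEnergy Ψ R h₂
  have hconv := infMeanEnergyOn_tiClassWith_convex_comb_le C Ψ R ⟨ω₁, h₁⟩ ⟨ω₂, h₂⟩ hl0
    (by linarith : 0 ≤ 1 - lam) (by ring)
  rw [meanEnergy_mix] at hGS
  refine le_antisymm ?_ hv₂
  have k1 := mul_le_mul_of_nonneg_left hv₁ hl0
  by_contra hlt
  have hlt' := lt_of_not_ge hlt
  have k2 : (1 - lam) * infMeanEnergyOn (tiClassWith C R c₂) Ψ R < (1 - lam) * ω₂.meanEnergy Ψ R :=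
    mul_lt_mul_of_pos_left hlt' (by linarith)
  linarith

/-! ### §2 Coexistence makes `e` affine on the whole charge segment -/

/-- **Coexistence makes `c ↦ e_c(Ψ)` affine on the segment `[c₁, c₂]`** (`0 < λ < 1`): for all `p, q ≥ 0`,
`p + q = 1`: `e_{p c₁ + q c₂} = p e_{c₁} + q e_{c₂}`. [cite: Israel1979, Thm. I.2.4] -/
theorem infMeanEnergyOn_tiClassWith_eq_chord_on_segment_of_mix_le {c₁ c₂ : κ → ℝ}
    {ω₁ ω₂ : InfVolFermionState d} (h₁ : ω₁ ∈ tiClassWith C R c₁) (h₂ : ω₂ ∈ tiClassWith C R c₂)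
    {lam : ℝ} (hl0 : 0 < lam) (hl1 : lam < 1)
    (hGS : (mix lam hl0.le hl1.le ω₁ ω₂).meanEnergy Ψ R ≤
      infMeanEnergyOn (tiClassWith C R (fun k => lam * c₁ k + (1 - lam) * c₂ k)) Ψ R)
    {p q : ℝ} (hp : 0 ≤ p) (hq : 0 ≤ q) (hpq : p + q = 1) :
    infMeanEnergyOn (tiClassWith C R (fun k => p * c₁ k + q * c₂ k)) Ψ R =
      p * infMeanEnergyOn (tiClassWith C R c₁) Ψ R + q * infMeanEnergyOn (tiClassWith C R c₂) Ψ R := by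
  have heq := infMeanEnergyOn_tiClassWith_eq_convexComb_of_mix_le C Ψ R h₁ h₂ hl0.le hl1.le hGS
  have hf := convexOn_infMeanEnergyOn_tiClassWith_segment C Ψ R h₁ h₂
  -- values of the restriction at 0, 1, 1 - lam, q
  have e0 : infMeanEnergyOn (tiClassWith C R (fun k => (1 - (lam * 0 + (1 - lam) * 1)) * c₁ k +
      (lam * 0 + (1 - lam) * 1) * c₂ k)) Ψ R =
      infMeanEnergyOn (tiClassWith C R (fun k => lam * c₁ k + (1 - lam) * c₂ k)) Ψ R :=
    congrArg (fun v => infMeanEnergyOn (tiClassWith C R v) Ψ R) (funext fun k => by ring)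
  have eA : infMeanEnergyOn (tiClassWith C R (fun k => (1 - (0 : ℝ)) * c₁ k + (0 : ℝ) * c₂ k)) Ψ R =
      infMeanEnergyOn (tiClassWith C R c₁) Ψ R :=
    congrArg (fun v => infMeanEnergyOn (tiClassWith C R v) Ψ R) (funext fun k => by ring)
  have eB : infMeanEnergyOn (tiClassWith C R (fun k => (1 - (1 : ℝ)) * c₁ k + (1 : ℝ) * c₂ k)) Ψ R =
      infMeanEnergyOn (tiClassWith C R c₂) Ψ R :=
    congrArg (fun v => infMeanEnergyOn (tiClassWith C R v) Ψ R) (funext fun k => by ring)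
  have eQ : infMeanEnergyOn (tiClassWith C R (fun k => (1 - (p * 0 + q * 1)) * c₁ k +
      (p * 0 + q * 1) * c₂ k)) Ψ R =
      infMeanEnergyOn (tiClassWith C R (fun k => p * c₁ k + q * c₂ k)) Ψ R :=
    congrArg (fun v => infMeanEnergyOn (tiClassWith C R v) Ψ R) (funext fun k => by
      have hp' : p = 1 - q := by linarith
      rw [hp']; ring)
  have hchord : (fun s : ℝ => infMeanEnergyOn (tiClassWith C R (fun k => (1 - s) * c₁ k + s * c₂ k)) Ψ R)
      (lam * 0 + (1 - lam) * 1) =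
      lam * (fun s : ℝ => infMeanEnergyOn (tiClassWith C R (fun k => (1 - s) * c₁ k + s * c₂ k)) Ψ R) 0 +
        (1 - lam) * (fun s : ℝ => infMeanEnergyOn (tiClassWith C R (fun k => (1 - s) * c₁ k + s * c₂ k)) Ψ R) 1 := by
    simp only []
    rw [e0, eA, eB]
    exact heq
  have key := convexOn_affine_of_eq_convexComb hf (x := 0) (y := 1) ⟨le_rfl, zero_le_one⟩
    ⟨zero_le_one, le_rfl⟩ hl0 (by linarith : 0 < 1 - lam) (by ring) hchord hp hq hpq
  have key' : infMeanEnergyOn (tiClassWith C R (fun k => (1 - (p * 0 + q * 1)) * c₁ k +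
      (p * 0 + q * 1) * c₂ k)) Ψ R =
      p * infMeanEnergyOn (tiClassWith C R (fun k => (1 - (0 : ℝ)) * c₁ k + (0 : ℝ) * c₂ k)) Ψ R +
        q * infMeanEnergyOn (tiClassWith C R (fun k => (1 - (1 : ℝ)) * c₁ k + (1 : ℝ) * c₂ k)) Ψ R := key
  rw [eQ, eA, eB] at key'
  exact key'

/-! ### §3 Exclusion readings -/

/-- **Strict convexity at the mixture's charges excludes coexistence.** If at some interior point
`a c₁ + b c₂` (`a, b ≥ 0`, `a + b = 1`) `e_{a c₁ + b c₂} < a e_{c₁} + b e_{c₂}`, then for every `0 < λ < 1` the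
mixture `λω₁ + (1−λ)ω₂` of ANY states of the classes `c₁, c₂` is NOT a constrained minimiser at its charges:
its mean energy is strictly above `e_{λc₁+(1−λ)c₂}`. [cite: Israel1979, Thm. I.2.4] [cite: EmeryKivelsonLin1990, pp. 475–476] -/
theorem infMeanEnergyOn_tiClassWith_lt_meanEnergy_mix_of_strict_at {c₁ c₂ : κ → ℝ}
    {ω₁ ω₂ : InfVolFermionState d} (h₁ : ω₁ ∈ tiClassWith C R c₁) (h₂ : ω₂ ∈ tiClassWith C R c₂)
    {a b : ℝ} (ha : 0 ≤ a) (hb : 0 ≤ b) (hab : a + b = 1)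
    (hstrict : infMeanEnergyOn (tiClassWith C R (fun k => a * c₁ k + b * c₂ k)) Ψ R <
      a * infMeanEnergyOn (tiClassWith C R c₁) Ψ R + b * infMeanEnergyOn (tiClassWith C R c₂) Ψ R)
    {lam : ℝ} (hl0 : 0 < lam) (hl1 : lam < 1) :
    infMeanEnergyOn (tiClassWith C R (fun k => lam * c₁ k + (1 - lam) * c₂ k)) Ψ R <
      (mix lam hl0.le hl1.le ω₁ ω₂).meanEnergy Ψ R := by
  by_contra hle
  have hle' := le_of_not_gt hle
  have haff := infMeanEnergyOn_tiClassWith_eq_chord_on_segment_of_mix_le C Ψ R h₁ h₂ hl0 hl1 hle' ha hb hab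
  linarith

/-- **Certified exclusion from windows on the constrained energies.** A certified CAP `e_{a c₁ + b c₂} ≤ u`
and certified FLOORS `f₁ ≤ e_{c₁}`, `f₂ ≤ e_{c₂}` with `u < a f₁ + b f₂` exclude coexistence of the phases
`c₁, c₂` at every mixing ratio. [cite: EmeryKivelsonLin1990, pp. 475–476] -/
theorem infMeanEnergyOn_tiClassWith_lt_meanEnergy_mix_of_cap_lt_floors {c₁ c₂ : κ → ℝ}
    {ω₁ ω₂ : InfVolFermionState d} (h₁ : ω₁ ∈ tiClassWith C R c₁) (h₂ : ω₂ ∈ tiClassWith C R c₂)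
    {a b : ℝ} (ha : 0 ≤ a) (hb : 0 ≤ b) (hab : a + b = 1) {u f₁ f₂ : ℝ}
    (hcap : infMeanEnergyOn (tiClassWith C R (fun k => a * c₁ k + b * c₂ k)) Ψ R ≤ u)
    (hf₁ : f₁ ≤ infMeanEnergyOn (tiClassWith C R c₁) Ψ R)
    (hf₂ : f₂ ≤ infMeanEnergyOn (tiClassWith C R c₂) Ψ R) (hu : u < a * f₁ + b * f₂)
    {lam : ℝ} (hl0 : 0 < lam) (hl1 : lam < 1) :
    infMeanEnergyOn (tiClassWith C R (fun k => lam * c₁ k + (1 - lam) * c₂ k)) Ψ R <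
      (mix lam hl0.le hl1.le ω₁ ω₂).meanEnergy Ψ R := by
  refine infMeanEnergyOn_tiClassWith_lt_meanEnergy_mix_of_strict_at C Ψ R h₁ h₂ ha hb hab ?_ hl0 hl1
  have k1 := mul_le_mul_of_nonneg_left hf₁ ha
  have k2 := mul_le_mul_of_nonneg_left hf₂ hb
  linarith

/-- **Super-segment form.** Let the phases `ω₁, ω₂` have charges `c₁, c₂` and let the certified defect sit on a
SUB-segment: inner points `(1−s₁)c₁ + s₁c₂`, `(1−s₂)c₁ + s₂c₂` (`0 ≤ s₁ < s₂ ≤ 1`) and weights `a, b` with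
`e_{a·inner₁ + b·inner₂} < a e_{inner₁} + b e_{inner₂}`. Then NO mixture `λω₁ + (1−λ)ω₂` (`0 < λ < 1`) is a
constrained minimiser — coexistence of every pair of phases whose charges lie on the line through the defect,
outside its sub-segment, is excluded by the one defect. [cite: Israel1979, Thm. I.2.4] -/
theorem infMeanEnergyOn_tiClassWith_lt_meanEnergy_mix_of_strict_at_of_mem_segment {c₁ c₂ : κ → ℝ}
    {ω₁ ω₂ : InfVolFermionState d} (h₁ : ω₁ ∈ tiClassWith C R c₁) (h₂ : ω₂ ∈ tiClassWith C R c₂)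
    {s₁ s₂ : ℝ} (hs₁ : 0 ≤ s₁) (hs : s₁ < s₂) (hs₂ : s₂ ≤ 1)
    {a b : ℝ} (ha : 0 ≤ a) (hb : 0 ≤ b) (hab : a + b = 1)
    (hstrict : infMeanEnergyOn (tiClassWith C R (fun k =>
        a * ((1 - s₁) * c₁ k + s₁ * c₂ k) + b * ((1 - s₂) * c₁ k + s₂ * c₂ k))) Ψ R <
      a * infMeanEnergyOn (tiClassWith C R (fun k => (1 - s₁) * c₁ k + s₁ * c₂ k)) Ψ R +
        b * infMeanEnergyOn (tiClassWith C R (fun k => (1 - s₂) * c₁ k + s₂ * c₂ k)) Ψ R)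
    {lam : ℝ} (hl0 : 0 < lam) (hl1 : lam < 1) :
    infMeanEnergyOn (tiClassWith C R (fun k => lam * c₁ k + (1 - lam) * c₂ k)) Ψ R <
      (mix lam hl0.le hl1.le ω₁ ω₂).meanEnergy Ψ R := by
  by_contra hle
  have hle' := le_of_not_gt hle
  -- the restriction to the segment is affine …
  have haff : ∀ {p q : ℝ}, 0 ≤ p → 0 ≤ q → p + q = 1 →
      (fun s : ℝ => infMeanEnergyOn (tiClassWith C R (fun k => (1 - s) * c₁ k + s * c₂ k)) Ψ R) (p * 0 + q * 1) =
        p * (fun s : ℝ => infMeanEnergyOn (tiClassWith C R (fun k => (1 - s) * c₁ k + s * c₂ k)) Ψ R) 0 +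
        q * (fun s : ℝ => infMeanEnergyOn (tiClassWith C R (fun k => (1 - s) * c₁ k + s * c₂ k)) Ψ R) 1 := by
    intro p q hp hq hpq
    have h := infMeanEnergyOn_tiClassWith_eq_chord_on_segment_of_mix_le C Ψ R h₁ h₂ hl0 hl1 hle' hp hq hpq
    have eQ : infMeanEnergyOn (tiClassWith C R (fun k => (1 - (p * 0 + q * 1)) * c₁ k +
        (p * 0 + q * 1) * c₂ k)) Ψ R =
        infMeanEnergyOn (tiClassWith C R (fun k => p * c₁ k + q * c₂ k)) Ψ R :=
      congrArg (fun v => infMeanEnergyOn (tiClassWith C R v) Ψ R) (funext fun k => by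
        have hp' : p = 1 - q := by linarith
        rw [hp']; ring)
    have eA : infMeanEnergyOn (tiClassWith C R (fun k => (1 - (0 : ℝ)) * c₁ k + (0 : ℝ) * c₂ k)) Ψ R =
        infMeanEnergyOn (tiClassWith C R c₁) Ψ R :=
      congrArg (fun v => infMeanEnergyOn (tiClassWith C R v) Ψ R) (funext fun k => by ring)
    have eB : infMeanEnergyOn (tiClassWith C R (fun k => (1 - (1 : ℝ)) * c₁ k + (1 : ℝ) * c₂ k)) Ψ R =
        infMeanEnergyOn (tiClassWith C R c₂) Ψ R :=
      congrArg (fun v => infMeanEnergyOn (tiClassWith C R v) Ψ R) (funext fun k => by ring)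
    simp only []
    rw [eQ, eA, eB]
    exact h
  -- … hence affine on the sub-chord [s₁, s₂]
  have hsub := affine_subchord_of_eq_chord
    (f := fun s : ℝ => infMeanEnergyOn (tiClassWith C R (fun k => (1 - s) * c₁ k + s * c₂ k)) Ψ R)
    (x := (0 : ℝ)) (y := 1) zero_lt_one (fun hp hq hpq => haff hp hq hpq)
    (u := s₁) (v := s₂) hs₁ (by linarith) (by linarith) hs₂ ha hb hab
  have eS : infMeanEnergyOn (tiClassWith C R (fun k => (1 - (a * s₁ + b * s₂)) * c₁ k +
      (a * s₁ + b * s₂) * c₂ k)) Ψ R =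
      infMeanEnergyOn (tiClassWith C R (fun k =>
        a * ((1 - s₁) * c₁ k + s₁ * c₂ k) + b * ((1 - s₂) * c₁ k + s₂ * c₂ k))) Ψ R :=
    congrArg (fun v => infMeanEnergyOn (tiClassWith C R v) Ψ R) (funext fun k => by
      have hb' : b = 1 - a := by linarith
      rw [hb']; ring)
  have hsub' : infMeanEnergyOn (tiClassWith C R (fun k => (1 - (a * s₁ + b * s₂)) * c₁ k +
      (a * s₁ + b * s₂) * c₂ k)) Ψ R =
      a * infMeanEnergyOn (tiClassWith C R (fun k => (1 - s₁) * c₁ k + s₁ * c₂ k)) Ψ R +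
        b * infMeanEnergyOn (tiClassWith C R (fun k => (1 - s₂) * c₁ k + s₂ * c₂ k)) Ψ R := hsub
  rw [eS] at hsub'
  linarith

/-- **Mean energy of a mixture from certified floors on the constrained energies** (`0 ≤ λ ≤ 1`):
`λ f₁ + (1−λ) f₂ ≤ e_Ψ(λω₁ + (1−λ)ω₂)` whenever `f_i ≤ e_{c_i}(Ψ)` and `ω_i ∈ tiClassWith C R c_i`
(`e_Ψ` is affine; each component obeys the variational principle). [cite: Ruelle1969, §3.4] -/
theorem convexComb_floors_le_meanEnergy_mix_tiClassWith {c₁ c₂ : κ → ℝ} {ω₁ ω₂ : InfVolFermionState d}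
    (h₁ : ω₁ ∈ tiClassWith C R c₁) (h₂ : ω₂ ∈ tiClassWith C R c₂) {f₁ f₂ : ℝ}
    (hf₁ : f₁ ≤ infMeanEnergyOn (tiClassWith C R c₁) Ψ R) (hf₂ : f₂ ≤ infMeanEnergyOn (tiClassWith C R c₂) Ψ R)
    {lam : ℝ} (hl0 : 0 ≤ lam) (hl1 : lam ≤ 1) :
    lam * f₁ + (1 - lam) * f₂ ≤ (mix lam hl0 hl1 ω₁ ω₂).meanEnergy Ψ R := by
  have hv₁ := infMeanEnergyOn_le_meanEnergy Ψ R h₁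
  have hv₂ := infMeanEnergyOn_le_meanEnergy Ψ R h₂
  rw [meanEnergy_mix]
  have k1 := mul_le_mul_of_nonneg_left (hf₁.trans hv₁) hl0
  have k2 := mul_le_mul_of_nonneg_left (hf₂.trans hv₂) (by linarith : 0 ≤ 1 - lam)
  linarith

/-- **Energy gap of the phase-separated state**: with, in addition, a certified CAP `e_{λc₁+(1−λ)c₂} ≤ u` at the
mixture's charges, `e_{λc₁+(1−λ)c₂} + (λf₁ + (1−λ)f₂ − u) ≤ e_Ψ(mixture)` — the mixture lies at least the
EXCLUSION MARGIN above the constrained ground-state energy density at its own charges. [cite: EmeryKivelsonLin1990, pp. 475–476] -/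
theorem infMeanEnergyOn_tiClassWith_add_margin_le_meanEnergy_mix {c₁ c₂ : κ → ℝ}
    {ω₁ ω₂ : InfVolFermionState d} (h₁ : ω₁ ∈ tiClassWith C R c₁) (h₂ : ω₂ ∈ tiClassWith C R c₂)
    {u f₁ f₂ : ℝ} (hf₁ : f₁ ≤ infMeanEnergyOn (tiClassWith C R c₁) Ψ R)
    (hf₂ : f₂ ≤ infMeanEnergyOn (tiClassWith C R c₂) Ψ R) {lam : ℝ} (hl0 : 0 ≤ lam) (hl1 : lam ≤ 1)
    (hcap : infMeanEnergyOn (tiClassWith C R (fun k => lam * c₁ k + (1 - lam) * c₂ k)) Ψ R ≤ u) :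
    infMeanEnergyOn (tiClassWith C R (fun k => lam * c₁ k + (1 - lam) * c₂ k)) Ψ R
        + (lam * f₁ + (1 - lam) * f₂ - u) ≤ (mix lam hl0 hl1 ω₁ ω₂).meanEnergy Ψ R := by
  have h := convexComb_floors_le_meanEnergy_mix_tiClassWith C Ψ R h₁ h₂ hf₁ hf₂ hl0 hl1
  linarith

end InfVolFermionState

end Literature.MathematicalPhysics.QuantumLattice

end
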